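import Literature.Analysis.FluidPDE.TorusClassicalHnBalance
import Summits.AnomalousDissipation.AnomalousDissipation.Theorems.MarginalStabilityChainChainRealisationStubTimeAvgLaplacianBound
import Summits.AnomalousDissipation.AnomalousDissipation.Theorems.MarginalStabilityChainChainRealisationStubUniformGronwall
import Summits.AnomalousDissipation.AnomalousDissipation.Theorems.MarginalStabilityChainChainRealisationStubH2NonlinearEstimate
import HarnessLib

/-!
# Stub `stub_laplacianSupBound` of the line `SketchIdeator2` (card `separatrix-flux-pinning`)
# (crux `MarginalStabilityChain.ChainRealisation`, stmt-AnomalousDissipation-14249)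

Sorry-free discharge of the registered stub `stub_laplacianSupBound` (S4): the **`H²` absorbing
bound** of a forward classical Navier–Stokes solution on `[0, ∞) × T³` at fixed viscosity — a
solution with mean-zero slices and enstrophy `‖∇u(t)‖₂² ≤ M` on `t ≥ 0` has `‖Δu(t)‖₂² ≤ M₂` on
`t ≥ 1` (Foias–Manley–Rosa–Temam 2001, Ch. II App. A §A.4 and Ch. III §2; Constantin–Foias 1988,
Ch. 13).  It assembles the three landed bricks of the line: the time-averaged `H²` bound
`stub_timeAvgLaplacianBound` (S1), the uniform Gronwall lemma `stub_uniformGronwall` (S2) and the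
`H²` nonlinear estimate `stub_h2NonlinearEstimate` (S3), with the `H²` balance of the tree
(`IsClassicalNSSolutionOn.hasDerivWithinAt_half_integral_norm_sq_laplacian_iterate`, `n = 1`).

Paper proof.  Put `y(s) = ‖Δu(s)‖₂²`, `G(s) = ‖∇Δu(s)‖₂²`.  (1) The `H²` balance on `[0, s+1]`
gives `y' = 2(−ν G − ∫ ⟪(u·∇)u − F, Δ²u⟫)` as a one-sided derivative within `[0, s+1]` at `s`,
hence from the right at `s`.  (2) By S3 (`C ≥ 0` after replacing `C` by `max C 0`),
`|∫ ⟪(u·∇)u, Δ²u⟫| ≤ (ν/2) G + C (1 + y)²`, and by Green twice and Cauchy–Schwarz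
`2 ∫ ⟪F, Δ²u⟫ = 2 ∫ ⟪ΔF, Δu⟫ ≤ ‖ΔF‖₂² + y`; so `y' ≤ 2C(1 + y)² + ‖ΔF‖₂² + y = g y + h` with
`g = 2C y + (4C + 1) ≥ 0` and the constant `h = 2C + ‖ΔF‖₂² ≥ 0`.  (3) S1 bounds the sliding
integrals `∫ₜ^{t+1} y ≤ C₁`, whence `∫ₜ^{t+1} g ≤ 2C C₁ + 4C + 1`.  (4) The uniform Gronwall lemma
S2 (`t₀ = 0`, `r = 1`) gives `y(t+1) ≤ (C₁ + 2C + ‖ΔF‖₂²) e^{2CC₁+4C+1}` for `t ≥ 0`.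
-/

set_option linter.dupNamespace false

noncomputable section

open MeasureTheory Set Filter Topology
open scoped InnerProductSpace
open Literature.Analysis.FunctionSpaces Literature.Analysis.FunctionSpaces.Torus
open Literature.Analysis.FluidPDE

namespace Summit.AnomalousDissipation.AnomalousDissipation.Theorems.ChainRealisation.SeparatrixFluxPinning

/-- Local notation: the torus `T³`. -/
local notation "𝕋³" => UnitAddTorus (Fin 3)
/-- Local notation: velocity values. -/
local notation "E³" => EuclideanSpace ℝ (Fin 3)

/-! ## The `H²` balance in non-iterate form -/

/-- The `H²` balance (`n = 1` case of
`IsClassicalNSSolutionOn.hasDerivWithinAt_half_integral_norm_sq_laplacian_iterate`), doubled and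
with the iterates `Δ^[1]`, `Δ^[2]` unfolded: within `[a, b]`,
`d/dt ‖Δu‖₂² = 2 (−ν ‖∇Δu‖₂² − ∫ ⟪(u·∇)u − F, Δ(Δu)⟫)`. -/
private theorem hasDerivWithinAt_integral_norm_sq_laplacian {a b ν : ℝ} {F : 𝕋³ → E³}
    {u : ℝ → 𝕋³ → E³} {p : ℝ → 𝕋³ → ℝ}
    (h : IsClassicalNSSolutionOn (Icc a b) ν (fun _ => F) u p) (hab : a < b) {t : ℝ}
    (ht : t ∈ Icc a b) :
    HasDerivWithinAt (fun s => ∫ x, ‖laplacian (u s) x‖ ^ 2)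
      (2 * (-ν * gradNormSq (laplacian (u t)) -
        ∫ x, ⟪convect (u t) (u t) x - F x, laplacian (laplacian (u t)) x⟫_ℝ)) (Icc a b) t := by
  have h1 := (h.hasDerivWithinAt_half_integral_norm_sq_laplacian_iterate hab 1 ht).const_mul (2 : ℝ)
  have hfun : (fun s => 2 * (2⁻¹ * ∫ x, ‖(laplacian^[1] (u s)) x‖ ^ 2)) =
      fun s => ∫ x, ‖laplacian (u s) x‖ ^ 2 := by
    funext s
    rw [mul_inv_cancel_left₀ (two_ne_zero : (2 : ℝ) ≠ 0), Function.iterate_one]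
  rw [hfun] at h1
  exact h1

/-! ## The force term -/

/-- The force term of the `H²` balance: `2 ∫ ⟪F, Δ(Δv)⟫ ≤ ‖ΔF‖₂² + ‖Δv‖₂²` for smooth `F`, `v`
on `T³` (Green's second identity `∫ ⟪F, Δ(Δv)⟫ = ∫ ⟪ΔF, Δv⟫`, then `2⟪a, b⟫ ≤ ‖a‖² + ‖b‖²`
pointwise and integrate). -/
private theorem two_mul_integral_inner_laplacian_laplacian_le {F v : 𝕋³ → E³}
    (hF : IsSmooth F) (hv : IsSmooth v) :
    2 * ∫ x, ⟪F x, laplacian (laplacian v) x⟫_ℝ ≤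
      (∫ x, ‖laplacian F x‖ ^ 2) + ∫ x, ‖laplacian v x‖ ^ 2 := by
  have hΔF : IsSmooth (laplacian F) := hF.laplacian
  have hΔv : IsSmooth (laplacian v) := hv.laplacian
  rw [← Torus.integral_inner_laplacian_comm hF hΔv, ← integral_const_mul,
    ← integral_add hΔF.norm_sq.integrable hΔv.norm_sq.integrable]
  refine integral_mono ((hΔF.inner hΔv).integrable.const_mul 2)
    (hΔF.norm_sq.integrable.add hΔv.norm_sq.integrable) fun x => ?_
  have h1 : ⟪laplacian F x, laplacian v x⟫_ℝ ≤ ‖laplacian F x‖ * ‖laplacian v x‖ :=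
    real_inner_le_norm _ _
  have h2 := two_mul_le_add_sq ‖laplacian F x‖ ‖laplacian v x‖
  show 2 * ⟪laplacian F x, laplacian v x⟫_ℝ ≤ ‖laplacian F x‖ ^ 2 + ‖laplacian v x‖ ^ 2
  linarith

/-! ## The real-analysis assembly (uniform Gronwall with `t₀ = 0`, `r = 1`) -/

/-- Assembly of the uniform Gronwall lemma S2 with `t₀ = 0`, `r = 1`, `g = 2C y + (4C + 1)` and the
constant `h = 2C + Φ`: if `y ≥ 0` is continuous on `[0, ∞)` with right derivative
`y' ≤ 2C(1 + y)² + Φ + y` (`C, Φ ≥ 0`) and `∫ₜ^{t+1} y ≤ C₁` for `t ≥ 0`, then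
`y(t) ≤ (C₁ + 2C + Φ) e^{2CC₁ + 4C + 1}` for `t ≥ 1`. -/
private theorem supBound_assembly (Y Y' : ℝ → ℝ) (C Φ C₁ : ℝ) (hC : 0 ≤ C) (hΦ : 0 ≤ Φ)
    (hYc : ContinuousOn Y (Set.Ici 0))
    (hYd : ∀ s : ℝ, 0 ≤ s → HasDerivWithinAt Y (Y' s) (Set.Ici s) s)
    (hineq : ∀ s : ℝ, 0 ≤ s → Y' s ≤ 2 * C * (1 + Y s) ^ 2 + Φ + Y s)
    (hY0 : ∀ s : ℝ, 0 ≤ s → 0 ≤ Y s)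
    (hIY : ∀ t : ℝ, 0 ≤ t → ∫ s in t..t + 1, Y s ≤ C₁) :
    ∀ t : ℝ, 1 ≤ t → Y t ≤ (C₁ / 1 + (2 * C + Φ)) * Real.exp (2 * C * C₁ + (4 * C + 1)) := by
  have hgc : ContinuousOn (fun s => 2 * C * Y s + (4 * C + 1)) (Set.Ici 0) :=
    (continuousOn_const.mul hYc).add continuousOn_const
  have hhc : ContinuousOn (fun _ : ℝ => 2 * C + Φ) (Set.Ici 0) := continuousOn_const
  have hineq' : ∀ s : ℝ, 0 ≤ s → Y' s ≤ (2 * C * Y s + (4 * C + 1)) * Y s + (2 * C + Φ) := by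
    intro s hs
    have e : (2 * C * Y s + (4 * C + 1)) * Y s + (2 * C + Φ) =
        2 * C * (1 + Y s) ^ 2 + Φ + Y s := by ring
    rw [e]
    exact hineq s hs
  have hg0 : ∀ s : ℝ, 0 ≤ s → 0 ≤ 2 * C * Y s + (4 * C + 1) := fun s hs =>
    add_nonneg (mul_nonneg (mul_nonneg zero_le_two hC) (hY0 s hs)) (by linarith)
  have hh0 : ∀ s : ℝ, (0 : ℝ) ≤ s → 0 ≤ 2 * C + Φ := fun _ _ =>
    add_nonneg (mul_nonneg zero_le_two hC) hΦ
  have hIg : ∀ t : ℝ, 0 ≤ t →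
      ∫ s in t..t + 1, (2 * C * Y s + (4 * C + 1)) ≤ 2 * C * C₁ + (4 * C + 1) := by
    intro t ht
    have hYi : IntervalIntegrable Y volume t (t + 1) :=
      uniformGronwall_intervalIntegrable hYc ht (lt_add_one t).le
    rw [intervalIntegral.integral_add (hYi.const_mul _) intervalIntegrable_const,
      intervalIntegral.integral_const_mul, intervalIntegral.integral_const, add_sub_cancel_left,
      one_smul]
    have := mul_le_mul_of_nonneg_left (hIY t ht) (mul_nonneg zero_le_two hC)
    linarith
  have hIh : ∀ t : ℝ, (0 : ℝ) ≤ t → ∫ _ in t..t + 1, (2 * C + Φ) ≤ 2 * C + Φ := by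
    intro t _
    rw [intervalIntegral.integral_const, add_sub_cancel_left, one_smul]
  intro t ht
  have key := stub_uniformGronwall Y Y' (fun s => 2 * C * Y s + (4 * C + 1)) (fun _ => 2 * C + Φ)
    0 1 (2 * C * C₁ + (4 * C + 1)) (2 * C + Φ) C₁ one_pos hYc hgc hhc hYd hineq' hY0 hg0 hh0 hIg
    hIh hIY (t - 1) (by linarith)
  rwa [sub_add_cancel] at key

/-! ## The stub -/

/-- Stub S4 (M–L) **the `H²` absorbing bound**: a forward classical solution with mean-zero slices and
`‖∇u(t)‖₂² ≤ M` on `t ≥ 0` has `‖Δu(t)‖₂² ≤ M₂` on `t ≥ 1`.  Proof: with `y(t) = ‖Δu(t)‖₂²`, the `H²` balance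
(`hasDerivWithinAt_half_integral_norm_sq_laplacian_iterate`, `n = 1`) and S3 give
`y' ≤ [2C y + 4C + 1]·y + (2C + ‖ΔF‖₂²)` from the right (`C ≥ 0` the constant of S3, the force term by Green
twice and Cauchy–Schwarz); S1 bounds `∫ₜ^{t+1} y ≤ C₁` and hence `∫ₜ^{t+1} g`; the uniform Gronwall lemma S2
(`r = 1`, `t₀ = 0`) gives `y(t+1) ≤ (C₁ + 2C + ‖ΔF‖₂²) e^{2CC₁+4C+1}` (Foias–Manley–Rosa–Temam 2001 Ch. II §A.4,
Ch. III §2; Constantin–Foias 1988 Ch. 13). -/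
theorem stub_laplacianSupBound :
    ∀ (ν M : ℝ) (F : 𝕋³ → E³) (u : ℝ → 𝕋³ → E³) (p : ℝ → 𝕋³ → ℝ),
      0 < ν → IsSmooth F → IsClassicalNSSolutionOn (Set.Ici 0) ν (fun _ => F) u p →
      (∀ t : ℝ, 0 ≤ t → gradNormSq (u t) ≤ M) → (∀ t : ℝ, 0 ≤ t → HasZeroMean (u t)) →
      ∃ M₂ : ℝ, ∀ t : ℝ, 1 ≤ t → ∫ x, ‖laplacian (u t) x‖ ^ 2 ≤ M₂ := by
  intro ν M F u p hν hF h hM hzm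
  -- the constants of S3 and S1
  have hM0 : 0 ≤ M := (gradNormSq_nonneg (u 0)).trans (hM 0 le_rfl)
  obtain ⟨C₀, hC₀⟩ := stub_h2NonlinearEstimate ν M hν hM0
  obtain ⟨C₁, hC₁⟩ := stub_timeAvgLaplacianBound ν M F u p hν hF h hM
  have hC : 0 ≤ max C₀ 0 := le_max_right _ _
  have hΦ : 0 ≤ ∫ x, ‖laplacian F x‖ ^ 2 := integral_nonneg fun _ => sq_nonneg _
  -- time continuity of `y(s) = ‖Δu(s)‖₂²` on `[0, ∞)`
  have hU : UniqueDiffOn ℝ (Ici (0 : ℝ)) := uniqueDiffOn_Ici 0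
  have hu : Torus.IsSmoothSpaceTimeOn (Ici (0 : ℝ)) u := h.smooth_velocity
  have hΔst : Torus.IsSmoothSpaceTimeOn (Ici (0 : ℝ)) (fun s => laplacian (u s)) :=
    hu.laplacian hU
  have hL2 : Torus.IsSmoothSpaceTimeOn (Ici (0 : ℝ)) (fun s x => ‖laplacian (u s) x‖ ^ 2) :=
    ContDiffOn.norm_sq ℝ hΔst
  have hYc : ContinuousOn (fun s => ∫ x, ‖laplacian (u s) x‖ ^ 2) (Ici (0 : ℝ)) :=
    hL2.continuousOn_integral (convex_Ici 0)
  -- (1) the `H²` balance, as a right derivative at every `s ≥ 0`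
  have hYd : ∀ s : ℝ, 0 ≤ s → HasDerivWithinAt (fun r => ∫ x, ‖laplacian (u r) x‖ ^ 2)
      (2 * (-ν * gradNormSq (laplacian (u s)) -
        ∫ x, ⟪convect (u s) (u s) x - F x, laplacian (laplacian (u s)) x⟫_ℝ)) (Ici s) s := by
    intro s hs
    have hs1 : (0 : ℝ) < s + 1 := by linarith
    have hS : Icc 0 (s + 1) ⊆ Ici (0 : ℝ) := fun r hr => mem_Ici.2 hr.1
    exact (hasDerivWithinAt_integral_norm_sq_laplacian (h.mono hS (uniqueDiffOn_Icc hs1)) hs1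
      ⟨hs, (lt_add_one s).le⟩).mono_of_mem_nhdsWithin (Icc_mem_nhdsGE_of_mem ⟨hs, lt_add_one s⟩)
  -- (2) the differential inequality `y' ≤ 2C(1 + y)² + ‖ΔF‖₂² + y`
  have hineq : ∀ s : ℝ, 0 ≤ s →
      2 * (-ν * gradNormSq (laplacian (u s)) -
        ∫ x, ⟪convect (u s) (u s) x - F x, laplacian (laplacian (u s)) x⟫_ℝ) ≤
      2 * max C₀ 0 * (1 + ∫ x, ‖laplacian (u s) x‖ ^ 2) ^ 2 + (∫ x, ‖laplacian F x‖ ^ 2) +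
        ∫ x, ‖laplacian (u s) x‖ ^ 2 := by
    intro s hs
    have hs0 : s ∈ Ici (0 : ℝ) := mem_Ici.2 hs
    have hus : IsSmooth (u s) := hu.isSmooth_slice hs0
    have hΔΔ : IsSmooth (laplacian (laplacian (u s))) := hus.laplacian.laplacian
    have hconv : IsSmooth (convect (u s) (u s)) := hus.convect hus
    have hsplit : (∫ x, ⟪convect (u s) (u s) x - F x, laplacian (laplacian (u s)) x⟫_ℝ) =
        (∫ x, ⟪convect (u s) (u s) x, laplacian (laplacian (u s)) x⟫_ℝ) -
          ∫ x, ⟪F x, laplacian (laplacian (u s)) x⟫_ℝ := by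
      simp only [inner_sub_left]
      exact integral_sub (hconv.inner hΔΔ).integrable (hF.inner hΔΔ).integrable
    have hN := (neg_le_abs _).trans (hC₀ (u s) hus (h.divFree s hs0) (hzm s hs) (hM s hs))
    have hCC : C₀ * (1 + ∫ x, ‖laplacian (u s) x‖ ^ 2) ^ 2 ≤
        max C₀ 0 * (1 + ∫ x, ‖laplacian (u s) x‖ ^ 2) ^ 2 :=
      mul_le_mul_of_nonneg_right (le_max_left _ _) (sq_nonneg _)
    have hP := two_mul_integral_inner_laplacian_laplacian_le hF hus
    have hνG : 0 ≤ ν * gradNormSq (laplacian (u s)) := mul_nonneg hν.le (gradNormSq_nonneg _)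
    rw [hsplit]
    linarith
  have hY0 : ∀ s : ℝ, 0 ≤ s → 0 ≤ ∫ x, ‖laplacian (u s) x‖ ^ 2 := fun _ _ =>
    integral_nonneg fun _ => sq_nonneg _
  -- (3)–(4) sliding integrals and the uniform Gronwall lemma
  exact ⟨_, supBound_assembly (fun s => ∫ x, ‖laplacian (u s) x‖ ^ 2)
    (fun s => 2 * (-ν * gradNormSq (laplacian (u s)) -
      ∫ x, ⟪convect (u s) (u s) x - F x, laplacian (laplacian (u s)) x⟫_ℝ))
    (max C₀ 0) (∫ x, ‖laplacian F x‖ ^ 2) C₁ hC hΦ hYc hYd hineq hY0 hC₁⟩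

end Summit.AnomalousDissipation.AnomalousDissipation.Theorems.ChainRealisation.SeparatrixFluxPinning

end
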